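import Summits.Ventures.PercRepro.SixFourRuleA

/-!
# PercRepro — C-025 at `(6,4)`: the hard max-trace rule on the solids, part B — supply, demand and the per-solid transfer (p3, gen 9)

Continues `SixFourRuleA.lean` (the rule `fHard` / `DHard` on the solids `flatsQ M 4` and the single-witness share
`w_∞(B) ≤ fHard G (B ∪ {x}) / DHard (B ∪ {x})`), mine-2's `MINE2-RLS.md` §21.0 / §25.1 with p2's
`PerFlatTransfer.lean`:

* SUPPLY — summing the single-point witnesses over the injective family `(B, x) ↦ B ∪ {x}` on
  `R₄(G) × (E ∖ G)`: `|E ∖ G| · Σ_{B ∈ R₄(G)} w_∞(B) ≤ Σ_{S ∈ Y} fHard G S / DHard S` (`supply_single_ge`).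
* DEMAND — with the TYPE `t = typeOf M G = 6 − ρ(E ∖ G)` (truncated at `0`): a bottom set `B ⊆ G` has
  `ρ(G ∖ B) ≥ t` (`6 = ρ(E ∖ B) ≤ ρ(E ∖ G) + ρ(G ∖ B)`), so it is not demand-free: `#U_G + DF_t ≤ N₄`
  (`card_UqG_add_DF_le`).
* TRANSFER — `perSolid_of_J_nonneg`: `0 ≤ J_t(G)` at `t = typeOf M G` gives the per-solid inequality
  `(6/5) · #U_G ≤ Σ_{S ∈ Y} fHard G S / Σ_{G'} fHard G' S` of `PerFlat.c025_of_perFlat_normalized`, since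
  `6 − t ≤ ρ(E ∖ G) ≤ |E ∖ G|` and `J_t = Σ (6 − t) w_∞ − (6/5)(N₄ − DF_t)`.

No simplicity or coloop-freeness is used here; `SixFourFrame.lean` composes this with the `|E|`-induction.
-/

namespace PercRepro.SixFour

open Finset ThmH PerFlat

variable {α : Type*} [DecidableEq α] {M : Matroid α} [M.Finite]

/-! ## The supply of a solid -/

/-- **Supply from the single-point witnesses**: `|E ∖ G| · Σ_{B ∈ R₄(G)} w_∞(B) ≤ Σ_{S ∈ Y} fHard G S / DHard S` —
the map `(B, x) ↦ B ∪ {x}` is injective from `R₄(G) × (E ∖ G)` into `Yq M 6 4`, every value has share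
`≥ w_∞(B)`, and every share is nonnegative. -/
theorem supply_single_ge {G : Finset α} (hG : G ∈ flatsQ M 4) :
    ((gr M \ G).card : ℚ) * ∑ B ∈ R4 M G, wInf M B ≤ ∑ S ∈ Yq M 6 4, fHard M G S / DHard M S := by
  have hGg : G ⊆ gr M := (mem_flatsQ.1 hG).1
  have hmaps : ∀ p ∈ R4 M G ×ˢ (gr M \ G), insert p.2 p.1 ∈ Yq M 6 4 := by
    intro p hp
    rw [Finset.mem_product] at hp
    obtain ⟨hB, hx⟩ := hp
    rw [mem_R4] at hB
    rw [Finset.mem_sdiff] at hx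
    rw [mem_Yq_six_four]
    refine ⟨Finset.insert_subset hx.1 (hB.1.trans hGg), ?_⟩
    rw [eRk_insert_eq_five hG hB.1 hB.2 hx.1 hx.2]
    exact ⟨by decide, by decide⟩
  have hinj : Set.InjOn (fun p : Finset α × α => insert p.2 p.1)
      ((R4 M G ×ˢ (gr M \ G) : Finset (Finset α × α)) : Set (Finset α × α)) := by
    intro p hp q hq hpq
    rw [Finset.mem_coe, Finset.mem_product] at hp hq
    simp only at hpq
    obtain ⟨hpB, hpx⟩ := hp
    obtain ⟨hqB, hqx⟩ := hq
    rw [mem_R4] at hpB hqB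
    rw [Finset.mem_sdiff] at hpx hqx
    have h1 : p.1 = q.1 := by
      rw [← insert_inter_eq hpB.1 hpx.2, ← insert_inter_eq hqB.1 hqx.2, hpq]
    have h2 : p.2 = q.2 := by
      have hx : p.2 ∈ insert q.2 q.1 := by
        rw [← hpq]
        exact Finset.mem_insert_self _ _
      rcases Finset.mem_insert.1 hx with h | h
      · exact h
      · exact absurd (hqB.1 h) hpx.2
    exact Prod.ext h1 h2
  calc ((gr M \ G).card : ℚ) * ∑ B ∈ R4 M G, wInf M B
      = ∑ B ∈ R4 M G, ∑ _x ∈ gr M \ G, wInf M B := by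
        rw [Finset.mul_sum]
        refine Finset.sum_congr rfl (fun B _ => ?_)
        rw [Finset.sum_const, nsmul_eq_mul]
    _ = ∑ p ∈ R4 M G ×ˢ (gr M \ G), wInf M p.1 := by
        rw [Finset.sum_product]
    _ ≤ ∑ p ∈ R4 M G ×ˢ (gr M \ G), fHard M G (insert p.2 p.1) / DHard M (insert p.2 p.1) := by
        apply Finset.sum_le_sum
        intro p hp
        rw [Finset.mem_product] at hp
        obtain ⟨hB, hx⟩ := hp
        rw [mem_R4] at hB
        rw [Finset.mem_sdiff] at hx
        exact share_single_ge hG hB.1 hB.2 hx.1 hx.2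
    _ = ∑ S ∈ (R4 M G ×ˢ (gr M \ G)).image (fun p : Finset α × α => insert p.2 p.1),
          fHard M G S / DHard M S := by
        rw [Finset.sum_image hinj]
    _ ≤ ∑ S ∈ Yq M 6 4, fHard M G S / DHard M S := by
        apply Finset.sum_le_sum_of_subset_of_nonneg
        · intro S hS
          rw [Finset.mem_image] at hS
          obtain ⟨p, hp, rfl⟩ := hS
          exact hmaps p hp
        · intro S _ _
          exact div_nonneg (fHard_nonneg G S) (DHard_nonneg S)

/-! ## The type of a solid and the demand -/

/-- The TYPE of `G`: `t = 6 − ρ(E ∖ G)`, truncated at `0` (mine-2 §19.0 / §21.0). -/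
noncomputable def typeOf (M : Matroid α) [M.Finite] (G : Finset α) : ℕ :=
  6 - (M.eRk ((gr M \ G : Finset α) : Set α)).toNat

/-- `t ≤ 6`. -/
theorem typeOf_le_six (G : Finset α) : typeOf M G ≤ 6 := Nat.sub_le _ _

/-- `6 − t ≤ |E ∖ G|` (through `6 − t ≤ ρ(E ∖ G) ≤ |E ∖ G|`). -/
theorem six_sub_typeOf_le_card (G : Finset α) : 6 - typeOf M G ≤ (gr M \ G).card := by
  obtain ⟨r, hr, hrle⟩ := eRk_eq_nat M (gr M \ G)
  unfold typeOf
  rw [hr, ENat.toNat_coe]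
  omega

/-- **Demand**: a bottom set `B` of the solid `G` has `ρ(G ∖ B) ≥ t` (`6 = ρ(E ∖ B) ≤ ρ(E ∖ G) + ρ(G ∖ B)`). -/
theorem typeOf_le_eRk_sdiff {G B : Finset α} (hB : B ∈ UqG M 6 4 G) :
    (typeOf M G : ℕ∞) ≤ M.eRk ((G \ B : Finset α) : Set α) := by
  obtain ⟨⟨-, -, h6⟩, -⟩ := mem_UqG_six_four.1 hB
  have hsub : gr M \ B ⊆ (gr M \ G) ∪ (G \ B) := by
    intro y hy
    rw [Finset.mem_sdiff] at hy
    rw [Finset.mem_union, Finset.mem_sdiff, Finset.mem_sdiff]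
    by_cases hyG : y ∈ G
    · exact Or.inr ⟨hyG, hy.2⟩
    · exact Or.inl ⟨hy.1, hyG⟩
  have h := M.eRk_union_le_eRk_add_eRk ((gr M \ G : Finset α) : Set α) ((G \ B : Finset α) : Set α)
  rw [← Finset.coe_union] at h
  have h' := (M.eRk_mono (Finset.coe_subset.2 hsub)).trans h
  rw [h6] at h'
  obtain ⟨r, hr, -⟩ := eRk_eq_nat M (gr M \ G)
  obtain ⟨k, hk, -⟩ := eRk_eq_nat M (G \ B)
  rw [hr, hk] at h'
  rw [hk]
  unfold typeOf
  rw [hr, ENat.toNat_coe]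
  have h6' : ((6 : ℕ) : ℕ∞) ≤ ((r + k : ℕ) : ℕ∞) := by
    push_cast
    exact h'
  have h6'' := (Nat.cast_le (α := ℕ∞)).1 h6'
  exact_mod_cast (by omega : 6 - r ≤ k)

/-- **`#U_G + DF_t ≤ N₄` at `t = typeOf M G`**: the bottom sets and the demand-free sets are disjoint subfamilies
of `R₄(G)`. -/
theorem card_UqG_add_DF_le (G : Finset α) :
    (UqG M 6 4 G).card + DF M G (typeOf M G) ≤ N4 M G := by
  classical
  unfold DF N4
  rw [← Finset.card_union_of_disjoint]
  · apply Finset.card_le_card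
    apply Finset.union_subset
    · intro B hB
      obtain ⟨⟨-, hr, -⟩, hBG⟩ := mem_UqG_six_four.1 hB
      exact mem_R4.2 ⟨hBG, hr⟩
    · exact Finset.filter_subset _ _
  · rw [Finset.disjoint_left]
    intro B hB hB'
    rw [Finset.mem_filter] at hB'
    have h1 := typeOf_le_eRk_sdiff hB
    have h2 := hB'.2
    obtain ⟨k, hk, -⟩ := eRk_eq_nat M (G \ B)
    rw [hk] at h1 h2
    have h1' : typeOf M G ≤ k := by exact_mod_cast h1
    have h2' : ((k + 1 : ℕ) : ℕ∞) ≤ (typeOf M G : ℕ∞) := by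
      push_cast
      exact h2
    have h2'' := (Nat.cast_le (α := ℕ∞)).1 h2'
    omega

/-! ## The per-solid transfer -/

/-- **The per-solid inequality from the balance `J_t ≥ 0`**: for a solid `G` of type `t = typeOf M G`,
`0 ≤ J M G t` gives `(6/5) · #U_G ≤ Σ_{S ∈ Y(6,4)} fHard G S / Σ_{G'} fHard G' S` — the hypothesis `hflat` of
`PerFlat.c025_of_perFlat_normalized` at `(6, 4)` with the hard max-trace rule. -/
theorem perSolid_of_J_nonneg {G : Finset α} (hG : G ∈ flatsQ M 4) (hJ : 0 ≤ J M G (typeOf M G)) :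
    (6 / 5 : ℚ) * ((UqG M 6 4 G).card : ℚ) ≤
      ∑ S ∈ Yq M 6 4, fHard M G S / ∑ G' ∈ flatsQ M 4, fHard M G' S := by
  have hgoal : (∑ S ∈ Yq M 6 4, fHard M G S / ∑ G' ∈ flatsQ M 4, fHard M G' S) =
      ∑ S ∈ Yq M 6 4, fHard M G S / DHard M S := rfl
  rw [hgoal]
  have hsupply := supply_single_ge hG
  have hdemand := card_UqG_add_DF_le (M := M) G
  have hW := six_sub_typeOf_le_card (M := M) G
  have hsum : 0 ≤ ∑ B ∈ R4 M G, wInf M B := Finset.sum_nonneg (fun B _ => (wInf_pos B).le)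
  have hJ' : (6 / 5 : ℚ) * ((N4 M G : ℚ) - (DF M G (typeOf M G) : ℚ)) ≤
      ((6 : ℚ) - (typeOf M G : ℚ)) * ∑ B ∈ R4 M G, wInf M B := by
    unfold J at hJ
    rw [← Finset.mul_sum] at hJ
    linarith
  have hW' : (6 : ℚ) - (typeOf M G : ℚ) ≤ ((gr M \ G).card : ℚ) := by
    have h := (Nat.cast_le (α := ℚ)).2 hW
    rwa [Nat.cast_sub (typeOf_le_six (M := M) G)] at h
  have hd : ((UqG M 6 4 G).card : ℚ) ≤ (N4 M G : ℚ) - (DF M G (typeOf M G) : ℚ) := by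
    have h : (((UqG M 6 4 G).card + DF M G (typeOf M G) : ℕ) : ℚ) ≤ (N4 M G : ℚ) := by
      exact_mod_cast hdemand
    rw [Nat.cast_add] at h
    linarith
  calc (6 / 5 : ℚ) * ((UqG M 6 4 G).card : ℚ)
      ≤ (6 / 5 : ℚ) * ((N4 M G : ℚ) - (DF M G (typeOf M G) : ℚ)) := by
        apply mul_le_mul_of_nonneg_left hd
        norm_num
    _ ≤ ((6 : ℚ) - (typeOf M G : ℚ)) * ∑ B ∈ R4 M G, wInf M B := hJ'
    _ ≤ ((gr M \ G).card : ℚ) * ∑ B ∈ R4 M G, wInf M B := mul_le_mul_of_nonneg_right hW' hsum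
    _ ≤ ∑ S ∈ Yq M 6 4, fHard M G S / DHard M S := hsupply

end PercRepro.SixFour
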